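/-
Copyright (c) 2026. All rights reserved.
Released under Apache 2.0 license as described in the file LICENSE.
-/
import Literature.Geometry.Kaehler.ComplexTorusQuaternionXSixSpecialCyclesPointCount
import Literature.Geometry.Kaehler.ComplexTorusQuaternionXSixAtkinLehnerSixFixedPointsCount
import Literature.Geometry.Kaehler.ComplexTorusQuaternionXSixAtkinLehnerFixedPointsCount
import HarnessLib

/-!
# The special points of `X₆`, a dictionary of TYPES: `Z(1) = Fix(ω₂) =` the order-`2` elliptic points,
# `Z(3) = Fix(ω₃) =` the order-`3` elliptic points, `Z(6) = Fix(ω₆)` — as bijections of quotient types over the identity of `ℌ`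

[tag: complex_torus] [tag: abelian_surface] [tag: quaternion_multiplication] [tag: complex_multiplication]
[tag: shimura_curve] [tag: special_cycles] [tag: elliptic_points] [tag: atkin_lehner]

Three families of quotient types of subsets of `ℌ` modulo `Γ₆ = O₆¹`-equivalence have been counted in this series:
the lifted supports `Pt(t)` of the special cycles `Z(t)` (`…XSixSpecialCyclesPointCount`: points fixed by a special vector
`x ∈ 𝔬`, `tr x = 0`, `nr x = t`), the elliptic fixed points of order `2` and `3` (`…XSixEllipticPointsCount`), and the lifted
fixed points of the Atkin–Lehner involutions `ω₂, ω₃, ω₆` (`…XSixAtkinLehnerFixedPointsCount`, `…SixFixedPointsCount`: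
points fixed by some `g ∈ O₆` of norm `2, 3, 6`). This file records that — not only their cardinalities `2, 2, 2` but — the
SETS agree: pointwise on `ℌ` the defining predicates are equivalent, so the identity of `ℌ` induces bijections of the
quotient types (`Equiv.subtypeEquivRight`, `Quot.congr`):

* `specialPoint_one_iff_orderTwo`, `specialPoint_one_iff_atkinLehnerTwo` (§1): fixed by a special vector of norm `1` ⟺
  fixed by an order-`4` element of `Γ₆` (`tr = 0`) ⟺ fixed by an element of `O₆` of norm `2`; the bijections
  `specialPoints_one_equiv_orderTwo_points`, `specialPoints_one_equiv_atkinLehnerTwo_fixedPoints` — «`Z(1) = {P₆, P₁₃₅} =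
  Fix(ω₂)`».
* `specialPoint_three_iff_orderThree`, `specialPoint_three_iff_atkinLehnerThree` (§2) and the bijections — «`Z(3) = {P₂, P₄} =
  Fix(ω₃)`».
* `specialPoint_six_iff_atkinLehnerSix` (§3) and the bijection — «`Z(6) = {P₀, P₇} = Fix(ω₆)`».

## The print

* A. P. Ogg (1983) [Ogg1983RealPoints] §2 p. 284 (fixed points of `w(m)`: `μ² = −m`, or `ε = 1 + ζ₄` (`m = 2`), `ε = 1 − ζ₃`
  (`m = 3`)). [cite: Ogg1983RealPoints, §2]
* S. Kudla, M. Rapoport, T. Yang (2006) [KudlaRapoportYang2006] §3.4 (3.4.9)–(3.4.11) («`D_x` the fixed locus», «`[Γ∖D_t] ≃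
  Z(t)_ℂ`»). [cite: KudlaRapoportYang2006, §3.4]
* P. Bayer, A. Travesa (2007) [BayerTravesa2007] §1 Thm. 1.1, §2 (the points `P₀, …, P₈`, the involutions `ω_d`).
  [cite: BayerTravesa2007, §1–§2]

## Scope (honest)

Theorems only — no definitions, no named facts, no instances; the statements are pointwise equivalences of inline
predicates on `ℂ ∖ ℝ` and `Nonempty (_ ≃ _)` between the corresponding bare `Quot` types (the equivalence IS
`Quot.congr (Equiv.subtypeEquivRight _)`, i.e. induced by the identity of `ℌ`, but only its existence is exported). Nothing
here identifies these classes with points of an algebraic model of `X₆`.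
-/

noncomputable section

set_option maxSynthPendingDepth 3

open Quaternion Function

namespace Literature.Geometry.Kaehler.ComplexTorus.QuaternionType

/-! ## §1 `Z(1) =` the order-`2` elliptic points `= Fix(ω₂)` -/

section One

/-- **Fixed by a special vector of norm `1` ⟺ fixed by an order-`4` element of `Γ₆`** (a special vector of norm `1` in `𝔬`
IS such an element; conversely a trace-zero unit of `O₆` lies in `𝔬` and has norm `1`, `mem_order_and_sq_eq_neg_one_of_maxOrder_unit_re_zero`).
[cite: KudlaRapoportYang2006, §3.4 (3.4.9)–(3.4.11)] [cite: BayerTravesa2007, §1 Thm. 1.1] -/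
theorem specialPoint_one_iff_orderTwo (τ : ℂ) :
    (∃ x : ℍ[ℚ,((-1 : ℤ) : ℚ),((3 : ℤ) : ℚ)], x ∈ order (-1) 3 ∧ x.re = 0 ∧ (x * star x).re = 1 ∧
        moebius (rho (-1) 3 (by norm_num) (castQ (-1) 3 x)) τ = τ) ↔
    (∃ u : ℍ[ℚ,((-1 : ℤ) : ℚ),((3 : ℤ) : ℚ)], (u ∈ order (-1) 3 ∨ u - ⟨1/2, 1/2, 1/2, -1/2⟩ ∈ order (-1) 3) ∧
        u * star u = 1 ∧ u.re = 0 ∧ moebius (rho (-1) 3 (by norm_num) (castQ (-1) 3 u)) τ = τ) := by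
  constructor
  · rintro ⟨x, hx, hre, hn, hfix⟩
    exact ⟨x, Or.inl hx, mul_star_eq_one_of_re hn, hre, hfix⟩
  · rintro ⟨u, hu, hu1, hre, hfix⟩
    obtain ⟨ho, hn, -⟩ := mem_order_and_sq_eq_neg_one_of_maxOrder_unit_re_zero hu hu1 hre
    exact ⟨u, ho, hre, hn, hfix⟩

/-- **Fixed by a special vector of norm `1` ⟺ fixed by an element of `O₆` of norm `2`** (`atkinLehnerTwo_fixedPoint_iff`).
[cite: Ogg1983RealPoints, §2 p. 284 («`ε = 1 + ζ₄`, if `m = 2`»)] -/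
theorem specialPoint_one_iff_atkinLehnerTwo {τ : ℂ} (hτ : τ.im ≠ 0) :
    (∃ x : ℍ[ℚ,((-1 : ℤ) : ℚ),((3 : ℤ) : ℚ)], x ∈ order (-1) 3 ∧ x.re = 0 ∧ (x * star x).re = 1 ∧
        moebius (rho (-1) 3 (by norm_num) (castQ (-1) 3 x)) τ = τ) ↔
    (∃ g : ℍ[ℚ,((-1 : ℤ) : ℚ),((3 : ℤ) : ℚ)], (g ∈ order (-1) 3 ∨ g - ⟨1/2, 1/2, 1/2, -1/2⟩ ∈ order (-1) 3) ∧
        (g * star g).re = 2 ∧ moebius (rho (-1) 3 (by norm_num) (castQ (-1) 3 g)) τ = τ) := by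
  rw [specialPoint_one_iff_orderTwo, atkinLehnerTwo_fixedPoint_iff hτ]

/-- **`Z(1)`-POINTS = ORDER-`2` ELLIPTIC POINTS as quotient types**: the identity of `ℌ` induces a bijection of the classes
modulo `Γ₆`. [cite: BayerTravesa2007, §1 Thm. 1.1 («`P₁ ≡ P₃ ≡ P₅ (mod Γ₆)` and `P₆` are elliptic of order `2`»)] [cite: KudlaRapoportYang2006, §3.4 (3.4.11)] -/
theorem specialPoints_one_equiv_orderTwo_points :
    Nonempty (Quot (fun p q : {τ : ℂ // 0 < τ.im ∧ ∃ x : ℍ[ℚ,((-1 : ℤ) : ℚ),((3 : ℤ) : ℚ)],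
        x ∈ order (-1) 3 ∧ x.re = 0 ∧ (x * star x).re = 1 ∧ moebius (rho (-1) 3 (by norm_num) (castQ (-1) 3 x)) τ = τ} ↦
      ∃ v : ℍ[ℚ,((-1 : ℤ) : ℚ),((3 : ℤ) : ℚ)], (v ∈ order (-1) 3 ∨ v - ⟨1/2, 1/2, 1/2, -1/2⟩ ∈ order (-1) 3) ∧
        v * star v = 1 ∧ moebius (rho (-1) 3 (by norm_num) (castQ (-1) 3 v)) p.1 = q.1) ≃
      Quot (fun p q : {τ : ℂ // 0 < τ.im ∧ ∃ u : ℍ[ℚ,((-1 : ℤ) : ℚ),((3 : ℤ) : ℚ)],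
        (u ∈ order (-1) 3 ∨ u - ⟨1/2, 1/2, 1/2, -1/2⟩ ∈ order (-1) 3) ∧ u * star u = 1 ∧ u.re = 0 ∧
        moebius (rho (-1) 3 (by norm_num) (castQ (-1) 3 u)) τ = τ} ↦
      ∃ v : ℍ[ℚ,((-1 : ℤ) : ℚ),((3 : ℤ) : ℚ)], (v ∈ order (-1) 3 ∨ v - ⟨1/2, 1/2, 1/2, -1/2⟩ ∈ order (-1) 3) ∧
        v * star v = 1 ∧ moebius (rho (-1) 3 (by norm_num) (castQ (-1) 3 v)) p.1 = q.1)) :=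
  ⟨Quot.congr (Equiv.subtypeEquivRight fun τ ↦ and_congr_right fun _ ↦ specialPoint_one_iff_orderTwo τ)
    fun _ _ ↦ Iff.rfl⟩

/-- **`Z(1)`-POINTS = FIXED POINTS OF `ω₂` as quotient types.** [cite: Ogg1983RealPoints, §2 p. 284] [cite: BayerTravesa2007, §2] -/
theorem specialPoints_one_equiv_atkinLehnerTwo_fixedPoints :
    Nonempty (Quot (fun p q : {τ : ℂ // 0 < τ.im ∧ ∃ x : ℍ[ℚ,((-1 : ℤ) : ℚ),((3 : ℤ) : ℚ)],
        x ∈ order (-1) 3 ∧ x.re = 0 ∧ (x * star x).re = 1 ∧ moebius (rho (-1) 3 (by norm_num) (castQ (-1) 3 x)) τ = τ} ↦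
      ∃ v : ℍ[ℚ,((-1 : ℤ) : ℚ),((3 : ℤ) : ℚ)], (v ∈ order (-1) 3 ∨ v - ⟨1/2, 1/2, 1/2, -1/2⟩ ∈ order (-1) 3) ∧
        v * star v = 1 ∧ moebius (rho (-1) 3 (by norm_num) (castQ (-1) 3 v)) p.1 = q.1) ≃
      Quot (fun p q : {τ : ℂ // 0 < τ.im ∧ ∃ g : ℍ[ℚ,((-1 : ℤ) : ℚ),((3 : ℤ) : ℚ)],
        (g ∈ order (-1) 3 ∨ g - ⟨1/2, 1/2, 1/2, -1/2⟩ ∈ order (-1) 3) ∧ (g * star g).re = 2 ∧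
        moebius (rho (-1) 3 (by norm_num) (castQ (-1) 3 g)) τ = τ} ↦
      ∃ v : ℍ[ℚ,((-1 : ℤ) : ℚ),((3 : ℤ) : ℚ)], (v ∈ order (-1) 3 ∨ v - ⟨1/2, 1/2, 1/2, -1/2⟩ ∈ order (-1) 3) ∧
        v * star v = 1 ∧ moebius (rho (-1) 3 (by norm_num) (castQ (-1) 3 v)) p.1 = q.1)) :=
  ⟨Quot.congr (Equiv.subtypeEquivRight fun _ ↦ and_congr_right fun hτ ↦ specialPoint_one_iff_atkinLehnerTwo hτ.ne')
    fun _ _ ↦ Iff.rfl⟩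

end One

/-! ## §2 `Z(3) =` the order-`3` elliptic points `= Fix(ω₃)` -/

section Three

/-- **Fixed by a special vector `x` of norm `3` ⟺ fixed by an elliptic `u ∈ Γ₆`, `u ≠ ±1`, `tr u ≠ 0`** (`u = (1 + x)/2`, the
order-`6` unit of `x`; conversely the trichotomy `maxOrder_unit_moebius_eq_trichotomy`). [cite: BayerTravesa2007, §1 Thm. 1.1] [cite: KudlaRapoportYang2006, §3.4 (3.4.9)–(3.4.11)] -/
theorem specialPoint_three_iff_orderThree {τ : ℂ} (hτ : τ.im ≠ 0) :
    (∃ x : ℍ[ℚ,((-1 : ℤ) : ℚ),((3 : ℤ) : ℚ)], x ∈ order (-1) 3 ∧ x.re = 0 ∧ (x * star x).re = 3 ∧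
        moebius (rho (-1) 3 (by norm_num) (castQ (-1) 3 x)) τ = τ) ↔
    (∃ u : ℍ[ℚ,((-1 : ℤ) : ℚ),((3 : ℤ) : ℚ)], (u ∈ order (-1) 3 ∨ u - ⟨1/2, 1/2, 1/2, -1/2⟩ ∈ order (-1) 3) ∧
        u * star u = 1 ∧ u ≠ 1 ∧ u ≠ -1 ∧ u.re ≠ 0 ∧ moebius (rho (-1) 3 (by norm_num) (castQ (-1) 3 u)) τ = τ) := by
  constructor
  · rintro ⟨x, hx, hre, hxn, hxfix⟩
    obtain ⟨hu, -, hu1, hure, -, -⟩ := maxOrder_unit_of_specialThree hx hre hxn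
    refine ⟨(1/2 : ℚ) • (1 + x), hu, hu1, ?_, ?_, by rw [hure]; norm_num, ?_⟩
    · intro h
      have h' := congrArg QuaternionAlgebra.re h
      rw [hure, QuaternionAlgebra.re_one] at h'
      norm_num at h'
    · intro h
      have h' := congrArg QuaternionAlgebra.re h
      rw [hure, QuaternionAlgebra.re_neg, QuaternionAlgebra.re_one] at h'
      norm_num at h'
    · exact (moebius_rho_half_one_add_eq_self_iff (by norm_num) hre (by rw [hxn]; norm_num) hτ).2 hxfix
  · rintro ⟨u, hu, hu1, h1, h1', hre, hfix⟩
    rcases maxOrder_unit_moebius_eq_trichotomy hu hu1 h1 h1' hτ hfix with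
      ⟨-, h0, -⟩ | ⟨x, hxO, hx0, hxQ, -, -, -, hxf⟩ | ⟨x, hxO, hx0, hxQ, -, -, -, hxf⟩
    · exact absurd h0 hre
    · exact ⟨x, hxO, hx0, hxQ, hxf⟩
    · exact ⟨x, hxO, hx0, hxQ, hxf⟩

/-- **Fixed by a special vector of norm `3` ⟺ fixed by an element of `O₆` of norm `3`** (`atkinLehnerThree_fixedPoint_iff`).
[cite: Ogg1983RealPoints, §2 p. 284 («`ε = 1 − ζ₃`, if `m = 3`»)] -/
theorem specialPoint_three_iff_atkinLehnerThree {τ : ℂ} (hτ : τ.im ≠ 0) :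
    (∃ x : ℍ[ℚ,((-1 : ℤ) : ℚ),((3 : ℤ) : ℚ)], x ∈ order (-1) 3 ∧ x.re = 0 ∧ (x * star x).re = 3 ∧
        moebius (rho (-1) 3 (by norm_num) (castQ (-1) 3 x)) τ = τ) ↔
    (∃ g : ℍ[ℚ,((-1 : ℤ) : ℚ),((3 : ℤ) : ℚ)], (g ∈ order (-1) 3 ∨ g - ⟨1/2, 1/2, 1/2, -1/2⟩ ∈ order (-1) 3) ∧
        (g * star g).re = 3 ∧ moebius (rho (-1) 3 (by norm_num) (castQ (-1) 3 g)) τ = τ) := by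
  rw [specialPoint_three_iff_orderThree hτ, atkinLehnerThree_fixedPoint_iff hτ]

/-- **`Z(3)`-POINTS = ORDER-`3` ELLIPTIC POINTS as quotient types.** [cite: BayerTravesa2007, §1 Thm. 1.1 («the remaining vertices `P₂, P₄` are elliptic of order `3`»)] [cite: KudlaRapoportYang2006, §3.4 (3.4.11)] -/
theorem specialPoints_three_equiv_orderThree_points :
    Nonempty (Quot (fun p q : {τ : ℂ // 0 < τ.im ∧ ∃ x : ℍ[ℚ,((-1 : ℤ) : ℚ),((3 : ℤ) : ℚ)],
        x ∈ order (-1) 3 ∧ x.re = 0 ∧ (x * star x).re = 3 ∧ moebius (rho (-1) 3 (by norm_num) (castQ (-1) 3 x)) τ = τ} ↦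
      ∃ v : ℍ[ℚ,((-1 : ℤ) : ℚ),((3 : ℤ) : ℚ)], (v ∈ order (-1) 3 ∨ v - ⟨1/2, 1/2, 1/2, -1/2⟩ ∈ order (-1) 3) ∧
        v * star v = 1 ∧ moebius (rho (-1) 3 (by norm_num) (castQ (-1) 3 v)) p.1 = q.1) ≃
      Quot (fun p q : {τ : ℂ // 0 < τ.im ∧ ∃ u : ℍ[ℚ,((-1 : ℤ) : ℚ),((3 : ℤ) : ℚ)],
        (u ∈ order (-1) 3 ∨ u - ⟨1/2, 1/2, 1/2, -1/2⟩ ∈ order (-1) 3) ∧ u * star u = 1 ∧ u ≠ 1 ∧ u ≠ -1 ∧ u.re ≠ 0 ∧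
        moebius (rho (-1) 3 (by norm_num) (castQ (-1) 3 u)) τ = τ} ↦
      ∃ v : ℍ[ℚ,((-1 : ℤ) : ℚ),((3 : ℤ) : ℚ)], (v ∈ order (-1) 3 ∨ v - ⟨1/2, 1/2, 1/2, -1/2⟩ ∈ order (-1) 3) ∧
        v * star v = 1 ∧ moebius (rho (-1) 3 (by norm_num) (castQ (-1) 3 v)) p.1 = q.1)) :=
  ⟨Quot.congr (Equiv.subtypeEquivRight fun _ ↦ and_congr_right fun hτ ↦ specialPoint_three_iff_orderThree hτ.ne')
    fun _ _ ↦ Iff.rfl⟩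

/-- **`Z(3)`-POINTS = FIXED POINTS OF `ω₃` as quotient types.** [cite: Ogg1983RealPoints, §2 p. 284] [cite: BayerTravesa2007, §2] -/
theorem specialPoints_three_equiv_atkinLehnerThree_fixedPoints :
    Nonempty (Quot (fun p q : {τ : ℂ // 0 < τ.im ∧ ∃ x : ℍ[ℚ,((-1 : ℤ) : ℚ),((3 : ℤ) : ℚ)],
        x ∈ order (-1) 3 ∧ x.re = 0 ∧ (x * star x).re = 3 ∧ moebius (rho (-1) 3 (by norm_num) (castQ (-1) 3 x)) τ = τ} ↦
      ∃ v : ℍ[ℚ,((-1 : ℤ) : ℚ),((3 : ℤ) : ℚ)], (v ∈ order (-1) 3 ∨ v - ⟨1/2, 1/2, 1/2, -1/2⟩ ∈ order (-1) 3) ∧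
        v * star v = 1 ∧ moebius (rho (-1) 3 (by norm_num) (castQ (-1) 3 v)) p.1 = q.1) ≃
      Quot (fun p q : {τ : ℂ // 0 < τ.im ∧ ∃ g : ℍ[ℚ,((-1 : ℤ) : ℚ),((3 : ℤ) : ℚ)],
        (g ∈ order (-1) 3 ∨ g - ⟨1/2, 1/2, 1/2, -1/2⟩ ∈ order (-1) 3) ∧ (g * star g).re = 3 ∧
        moebius (rho (-1) 3 (by norm_num) (castQ (-1) 3 g)) τ = τ} ↦
      ∃ v : ℍ[ℚ,((-1 : ℤ) : ℚ),((3 : ℤ) : ℚ)], (v ∈ order (-1) 3 ∨ v - ⟨1/2, 1/2, 1/2, -1/2⟩ ∈ order (-1) 3) ∧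
        v * star v = 1 ∧ moebius (rho (-1) 3 (by norm_num) (castQ (-1) 3 v)) p.1 = q.1)) :=
  ⟨Quot.congr (Equiv.subtypeEquivRight fun _ ↦ and_congr_right fun hτ ↦ specialPoint_three_iff_atkinLehnerThree hτ.ne')
    fun _ _ ↦ Iff.rfl⟩

end Three

/-! ## §3 `Z(6) = Fix(ω₆)` -/

section Six

/-- **Fixed by a special vector of norm `6` ⟺ fixed by an element of `O₆` of norm `6`** (such an element IS a special vector
of norm `6`: `atkinLehnerSix_fixed`; Ogg's generic case `μ² = −m`). [cite: Ogg1983RealPoints, §2 p. 284 («In general, `ε = −1` so `μ² = −m`»)] -/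
theorem specialPoint_six_iff_atkinLehnerSix {τ : ℂ} (hτ : τ.im ≠ 0) :
    (∃ x : ℍ[ℚ,((-1 : ℤ) : ℚ),((3 : ℤ) : ℚ)], x ∈ order (-1) 3 ∧ x.re = 0 ∧ (x * star x).re = 6 ∧
        moebius (rho (-1) 3 (by norm_num) (castQ (-1) 3 x)) τ = τ) ↔
    (∃ g : ℍ[ℚ,((-1 : ℤ) : ℚ),((3 : ℤ) : ℚ)], (g ∈ order (-1) 3 ∨ g - ⟨1/2, 1/2, 1/2, -1/2⟩ ∈ order (-1) 3) ∧
        (g * star g).re = 6 ∧ moebius (rho (-1) 3 (by norm_num) (castQ (-1) 3 g)) τ = τ) := by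
  constructor
  · rintro ⟨x, hx, -, hn, hfix⟩
    exact ⟨x, Or.inl hx, hn, hfix⟩
  · rintro ⟨g, hg, hn, hfix⟩
    obtain ⟨hgO, hgre⟩ := atkinLehnerSix_fixed hg hn hτ hfix
    exact ⟨g, hgO, hgre, hn, hfix⟩

/-- **`Z(6)`-POINTS = FIXED POINTS OF `ω₆` as quotient types** (the SCM points `P₀, P₇`). [cite: Ogg1983RealPoints, §2 p. 284] [cite: BayerTravesa2007, §2 Prop. 2.1 and §7 p. 332] -/
theorem specialPoints_six_equiv_atkinLehnerSix_fixedPoints :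
    Nonempty (Quot (fun p q : {τ : ℂ // 0 < τ.im ∧ ∃ x : ℍ[ℚ,((-1 : ℤ) : ℚ),((3 : ℤ) : ℚ)],
        x ∈ order (-1) 3 ∧ x.re = 0 ∧ (x * star x).re = 6 ∧ moebius (rho (-1) 3 (by norm_num) (castQ (-1) 3 x)) τ = τ} ↦
      ∃ v : ℍ[ℚ,((-1 : ℤ) : ℚ),((3 : ℤ) : ℚ)], (v ∈ order (-1) 3 ∨ v - ⟨1/2, 1/2, 1/2, -1/2⟩ ∈ order (-1) 3) ∧
        v * star v = 1 ∧ moebius (rho (-1) 3 (by norm_num) (castQ (-1) 3 v)) p.1 = q.1) ≃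
      Quot (fun p q : {τ : ℂ // 0 < τ.im ∧ ∃ g : ℍ[ℚ,((-1 : ℤ) : ℚ),((3 : ℤ) : ℚ)],
        (g ∈ order (-1) 3 ∨ g - ⟨1/2, 1/2, 1/2, -1/2⟩ ∈ order (-1) 3) ∧ (g * star g).re = 6 ∧
        moebius (rho (-1) 3 (by norm_num) (castQ (-1) 3 g)) τ = τ} ↦
      ∃ v : ℍ[ℚ,((-1 : ℤ) : ℚ),((3 : ℤ) : ℚ)], (v ∈ order (-1) 3 ∨ v - ⟨1/2, 1/2, 1/2, -1/2⟩ ∈ order (-1) 3) ∧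
        v * star v = 1 ∧ moebius (rho (-1) 3 (by norm_num) (castQ (-1) 3 v)) p.1 = q.1)) :=
  ⟨Quot.congr (Equiv.subtypeEquivRight fun _ ↦ and_congr_right fun hτ ↦ specialPoint_six_iff_atkinLehnerSix hτ.ne')
    fun _ _ ↦ Iff.rfl⟩

end Six

end Literature.Geometry.Kaehler.ComplexTorus.QuaternionType
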